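import Literature.NumberTheory.Sieve.BombieriFriedlanderIwaniecProofs
import Literature.NumberTheory.LFunctions.SiegelTheorem
import Literature.Barriers.Parity.SiegelZeroDichotomy
import HarnessLib

/-!
# Primes in the classes `χ(a) = 1` under an exceptional zero: Linnik's theorem in the exceptional
# case by Selberg's lower-bound sieve (Friedlander–Iwaniec 2023, Corollary 6.1)

Statement layer for the «illusory world» column (conditional consequences of exceptional zeros),
topic «primes in arithmetic progressions / Linnik constant». Source: J. B. Friedlander, H. Iwaniec,
*Selberg's sieve of irregular density*, Acta Arith. 209 (2023) 385–396 = arXiv:2206.03479 (held,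
tex) [FriedlanderIwaniec2023SelbergIrregular], §5 (5.9), §6 (6.1)–(6.4) and COROLLARY 6.1; companion
J. B. Friedlander, H. Iwaniec, *Sifting for small primes from an arithmetic progression*, Sci. China
Math. 66 (2023) 2715–2730 = arXiv:2303.06122 (held) [FriedlanderIwaniec2023SmallPrimes], §7 (7.3)
and Theorem 7.2.

## What the source prints

[FriedlanderIwaniec2023SelbergIrregular] §6 (`χ` "the real primitive character" mod `q`,
`λ = 1 ∗ χ`): (6.1) `∑_{q³ < p ≤ √x} λ(p)p⁻¹ < (1 − β) log x + O(q^{−3/4})` for `x ≥ q⁶`, `β` any real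
zero of `L(s, χ)` ((24.20) of *Opera de Cribro*); (6.3)–(6.4): the "exceptional condition" holds on
`q⁶ ≤ x ≤ e^{1/4(1−β)}`, non-empty iff `(1 − β) log q ≤ 1/24`; "If also `χ(a) = 1` its effect pulls in
an unfavourable direction." (5.9): `V(q) = ∏_{p < q²} (1 − 1/p)(1 − χ(p)/p)`.
**COROLLARY 6.1.** "Suppose `L(s, χ)` has a real zero `β` with `(1 − β) log q ≤ 1/172`. Let
`χ(a) = 1`. Then, for `q⁴³ ≤ x ≤ e^{1/4(1−β)}`, we have `π(x; q, a) ≥ L(1, χ) (V(q)/φ(q)) (x/168)`,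
where `V(q)` is the product (5.9)."
[FriedlanderIwaniec2023SmallPrimes] quotes it as (7.3) (`φ(q)π_f(x;q,a) ≥ L(1,χ₁)V(χ₁)x/168` "if
`χ₁(a) = 1` and `q⁴³ ≤ x ≤ e^{1/4(1−β₁)}`. This bound is derived in [FI3] by quite different arguments
using Selberg's lower bound sieve") inside Theorem 7.2 ("Let `q` be sufficiently large and
`(a, q) = 1`. We have `p_min(q, a) ≤ q^L` with `L = 75 744 000`"), whose proof uses (7.3) exactly in
the range `x ≤ e^{1/4(1−β₁)}`.

## Typing notes

* `π(x; q, a)` is the tree's `Literature.NumberTheory.Sieve.BFIReduction.piMod q a x`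
  (`#{p ≤ x : p ≡ a (mod q)}` as a real number); `L(1, χ)` is `(χ.LFunction 1).re` (real and
  positive for quadratic `χ ≠ χ₀`, `Literature.NumberTheory.LFunctions.Siegel.LFunction_one_re_pos`);
  `V(q)` is `FriedlanderIwaniec2023.sieveProduct χ` below; `e^{1/4(1−β)} = exp(1/(4(1 − β)))`
  (the reading fixed by (6.3)–(6.4): `q⁶ ≤ e^{1/4(1−β)}` iff `(1 − β) log q ≤ 1/24`).
* "`q` sufficiently large": the corollary is derived with ABSOLUTE implied constants ("We want this
  bound to be insignificant by comparison with the main term … This is the case if `x ≥ q⁴³`",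
  §6), i.e. for `q` beyond an absolute threshold, made explicit in the companion's Theorem 7.2
  ("Let `q` be sufficiently large") and its Remarks ("We assumed that `q` is sufficiently large");
  the fact below carries this threshold as `∃ q₀` (weaker than a threshold-free reading — safe).
* The hypothesis is a QUALITY hypothesis in the column's dictionary: `(1 − β) log q ≤ 1/172` says
  the zero `β = 1 − 1/(η log q)` has quality `η ≥ 172` (Tao–Teräväinen Definition 1.4,
  `Literature.Barriers.Parity.IsSiegelZero`); `172 = 4 · 43` is exactly what makes `x = q⁴³`
  admissible (`q⁴³ ≤ e^{1/4(1−β)} = q^{η/4}`). It is NOT voided by Siegel's theorem (`η ≪_ε q^ε`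
  allows every fixed quality) — contrast the S6 cases of the column.

## Contents

* `FriedlanderIwaniec2023.sieveProduct χ` — `V(q)` of (5.9) (PROVED positive, `sieveProduct_pos`);
* `friedlanderIwaniec2023_corollary61` — NAMED FACT, Corollary 6.1 AS PRINTED (with the threshold);
* PROVED reading on the column's predicate: `FriedlanderIwaniec2023.exists_prime_le_of_isSiegelZero`
  — modulo the fact, for `q ≥ q₀`, a Siegel zero of quality `η ≥ 172` attached to `χ` mod `q` puts
  a prime `p ≡ a (mod q)` below `q⁴³` in EVERY class with `χ(a) = 1` (the classes where the
  exceptional zero "pulls in an unfavourable direction": Page's main term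
  `x/φ(q) · (1 − χ(a)x^{β−1}/β)` is nearly annihilated there, cf.
  `Literature/NumberTheory/LFunctions/PagePNTWithExceptionalZero.lean`).

Index only (not typed): [FriedlanderIwaniec2023SelbergIrregular] Theorem 1 / Corollary 3.2 /
Proposition 5.1 (the lower-bound sieve of "irregular density" itself); [FriedlanderIwaniec2023SmallPrimes]
Theorem 7.2 (`L = 75 744 000`, unconditional, `q` large — the tree PROVES Linnik's theorem with
inexplicit constants, `Literature.NumberTheory.Sieve.linnik_leastPrimeAP`, and print has `L = 5`
(Xylouris 2011), so the explicit value is not vendored) and Lemma 7.1.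

LABEL: instrument / statement layer. WHAT THIS IS NOT: no claim that an exceptional zero exists; as a
least-prime bound the reading (`p ≤ q⁴³` on half of the classes) is weaker than the unconditional
printed Linnik constant `L = 5` — its content is the explicit LOWER BOUND for `π(x; q, a)` at
`x ∈ [q⁴³, e^{1/4(1−β)}]` in the annihilated classes, obtained by sieve alone; nothing here bears on
parity.

## References

* [FriedlanderIwaniec2023SelbergIrregular] J. B. Friedlander, H. Iwaniec, *Selberg's sieve of
  irregular density*, Acta Arith. 209 (2023) 385–396, doi:10.4064/aa220719-5-10 = arXiv:2206.03479:
  §5 (5.9), Proposition 5.1; §6 (6.1)–(6.4), Corollary 6.1.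
* [FriedlanderIwaniec2023SmallPrimes] J. B. Friedlander, H. Iwaniec, *Sifting for small primes from
  an arithmetic progression*, Sci. China Math. 66 (2023), no. 12, 2715–2730,
  doi:10.1007/s11425-022-2123-2 = arXiv:2303.06122: §7 Lemma 7.1, (7.3), Theorem 7.2 and Remarks.
* [TaoTeravainen2021] T. Tao, J. Teräväinen, J. London Math. Soc. 106 (2022), Definition 1.4
  (quality of a Siegel zero).
-/

noncomputable section

open Finset Real
open Literature.Barriers.Parity
open Literature.NumberTheory.Sieve

namespace Literature.NumberTheory.LFunctions

namespace FriedlanderIwaniec2023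

/-- `V(q) = ∏_{p < q²} (1 − 1/p)(1 − χ(p)/p)` — the product (5.9) of Friedlander–Iwaniec 2023 (for a
real character `χ` mod `q`; `χ(p)` enters through its real part, `χ(p) ∈ {0, ±1}`).
[cite: FriedlanderIwaniec2023SelbergIrregular, §5 (5.9)] -/
def sieveProduct {q : ℕ} [NeZero q] (χ : DirichletCharacter ℂ q) : ℝ :=
  ∏ p ∈ (Finset.range (q ^ 2)).filter Nat.Prime, (1 - 1 / (p : ℝ)) * (1 - (χ p).re / p)

/-- Each factor of `V(q)` is positive: for a prime `p` and `|χ(p)| ≤ 1`,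
`(1 − 1/p)(1 − Re χ(p)/p) ≥ (1 − 1/p)² > 0`. [cite: FriedlanderIwaniec2023SelbergIrregular, §5 (5.9)] -/
theorem sieveProduct_pos {q : ℕ} [NeZero q] (χ : DirichletCharacter ℂ q) : 0 < sieveProduct χ := by
  unfold sieveProduct
  apply Finset.prod_pos
  intro p hp
  have hprime : p.Prime := (Finset.mem_filter.mp hp).2
  have hp2 : (2 : ℝ) ≤ p := by exact_mod_cast hprime.two_le
  have hp0 : (0 : ℝ) < p := by linarith
  have h1 : 0 < 1 - 1 / (p : ℝ) := by
    rw [sub_pos, div_lt_one hp0]; linarith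
  have hre : (χ p).re ≤ 1 := le_trans (Complex.re_le_norm _) (DirichletCharacter.norm_le_one χ _)
  have h2 : 0 < 1 - (χ p).re / p := by
    rw [sub_pos, div_lt_one hp0]; linarith
  exact mul_pos h1 h2

end FriedlanderIwaniec2023

/-- **Friedlander–Iwaniec 2023, Corollary 6.1** (NAMED FACT, AS PRINTED, with the notes' standing
"`q` sufficiently large" as an explicit threshold `q₀`): for `q ≥ q₀`, `χ` the real primitive
character mod `q`, a real zero `β` of `L(s, χ)` with `(1 − β) log q ≤ 1/172`, a class `a` with
`χ(a) = 1`, and `q⁴³ ≤ x ≤ e^{1/4(1−β)}`: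
`π(x; q, a) ≥ L(1, χ) · (V(q)/φ(q)) · (x/168)`. Not proved here (Selberg's lower-bound sieve of
irregular density, Theorem 1/Proposition 5.1 of the source, with (24.20) of *Opera de Cribro*).
[cite: FriedlanderIwaniec2023SelbergIrregular, §6 Corollary 6.1 with (5.9), (6.3)–(6.4)]
[cite: FriedlanderIwaniec2023SmallPrimes, §7 (7.3) and Theorem 7.2 ("Let q be sufficiently large")] -/
def friedlanderIwaniec2023_corollary61 : Prop :=
  ∃ q₀ : ℕ, ∀ (q : ℕ) [NeZero q] (χ : DirichletCharacter ℂ q) (β : ℝ) (a : ZMod q) (x : ℝ),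
    q₀ ≤ q → χ.IsPrimitive → χ.IsQuadratic → χ.LFunction (β : ℂ) = 0 →
    (1 - β) * Real.log q ≤ 1 / 172 → χ a = 1 →
    (q : ℝ) ^ (43 : ℕ) ≤ x → x ≤ Real.exp (1 / (4 * (1 - β))) →
      (χ.LFunction 1).re * (FriedlanderIwaniec2023.sieveProduct χ / (Nat.totient q : ℝ)) * (x / 168)
        ≤ BFIReduction.piMod q a x

namespace FriedlanderIwaniec2023

/-- If `π(x; q, a) > 0` then there is a prime `p ≤ x` with `p ≡ a (mod q)` (the count is a sum of
indicators over `n ≤ ⌊x⌋`). [folklore] -/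
private theorem exists_prime_of_piMod_pos {q : ℕ} {a : ZMod q} {x : ℝ} (hx : 0 ≤ x)
    (h : 0 < BFIReduction.piMod q a x) :
    ∃ p : ℕ, p.Prime ∧ (p : ZMod q) = a ∧ (p : ℝ) ≤ x := by
  unfold BFIReduction.piMod at h
  have h' : ∑ _n ∈ Icc 0 ⌊x⌋₊, (0 : ℝ) < ∑ n ∈ Icc 0 ⌊x⌋₊, BFIReduction.primeInd q a n := by
    simpa using h
  obtain ⟨n, hn, hpos⟩ := Finset.exists_lt_of_sum_lt h'
  unfold BFIReduction.primeInd at hpos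
  split_ifs at hpos with hcase
  · refine ⟨n, hcase.2, hcase.1, ?_⟩
    have hn' : n ≤ ⌊x⌋₊ := (Finset.mem_Icc.mp hn).2
    exact le_trans (by exact_mod_cast hn') (Nat.floor_le hx)
  · exact absurd hpos (lt_irrefl 0)

/-- **The least prime in the annihilated classes under a Siegel zero of quality `≥ 172`** (PROVED
modulo `friedlanderIwaniec2023_corollary61`): for `q ≥ q₀` (the fact's threshold, and `q ≥ 2`), if
`χ` mod `q` carries a Siegel zero of quality `η ≥ 172` (Tao–Teräväinen: `χ` primitive quadratic,
`L(1 − 1/(η log q), χ) = 0`), then every class `a` with `χ(a) = 1` contains a prime `p ≤ q⁴³`.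
Indeed `β = 1 − 1/(η log q)` has `(1 − β) log q = 1/η ≤ 1/172` and `e^{1/4(1−β)} = q^{η/4} ≥ q⁴³`,
so Corollary 6.1 applies at `x = q⁴³`, where its right side is `> 0` (`L(1,χ) > 0`, `V(q) > 0`).
[cite: FriedlanderIwaniec2023SelbergIrregular, §6 Corollary 6.1] [cite: TaoTeravainen2021, Definition 1.4] -/
theorem exists_prime_le_of_isSiegelZero (h : friedlanderIwaniec2023_corollary61) :
    ∃ q₀ : ℕ, ∀ (q : ℕ) [NeZero q] (χ : DirichletCharacter ℂ q) (η : ℝ), q₀ ≤ q →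
      IsSiegelZero χ η → 172 ≤ η → ∀ a : ZMod q, χ a = 1 →
        ∃ p : ℕ, p.Prime ∧ (p : ZMod q) = a ∧ (p : ℝ) ≤ (q : ℝ) ^ (43 : ℕ) := by
  obtain ⟨q₀, hq₀⟩ := h
  refine ⟨max q₀ 2, fun q _ χ η hq hSZ hη a ha => ?_⟩
  obtain ⟨hprim, hquad, h10, hzero⟩ := hSZ
  have hq2 : 2 ≤ q := le_trans (le_max_right _ _) hq
  have hq2r : (2 : ℝ) ≤ q := by exact_mod_cast hq2
  have hq0r : (0 : ℝ) < q := by linarith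
  have hlog0 : 0 < Real.log q := Real.log_pos (by linarith)
  have hη0 : 0 < η := by linarith
  -- `χ ≠ 1`: a primitive character of modulus `≥ 2` is not principal
  have hne : χ ≠ 1 := by
    intro hχ
    have hcond : χ.conductor = q := (DirichletCharacter.isPrimitive_def χ).mp hprim
    rw [hχ, DirichletCharacter.conductor_one] at hcond
    omega
  set β : ℝ := 1 - 1 / (η * Real.log q) with hβdef
  have h1β : 1 - β = 1 / (η * Real.log q) := by rw [hβdef]; ring
  have hqual : (1 - β) * Real.log q ≤ 1 / 172 := by
    rw [h1β, one_div, mul_inv, mul_assoc, inv_mul_cancel₀ hlog0.ne', mul_one, ← one_div]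
    exact one_div_le_one_div_of_le (by norm_num) hη
  set x : ℝ := (q : ℝ) ^ (43 : ℕ) with hxdef
  have hx0 : 0 ≤ x := by positivity
  -- `x = q⁴³ ≤ exp(η log q / 4) = e^{1/4(1−β)}`
  have hxle : x ≤ Real.exp (1 / (4 * (1 - β))) := by
    have hexp : 1 / (4 * (1 - β)) = (η / 4) * Real.log q := by
      rw [h1β]; field_simp
    rw [hexp, hxdef]
    have hq43 : ((q : ℝ) ^ (43 : ℕ)) = Real.exp (43 * Real.log q) := by
      rw [← Real.rpow_natCast, Real.rpow_def_of_pos hq0r]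
      congr 1; push_cast; ring
    rw [hq43, Real.exp_le_exp]
    have : (43 : ℝ) ≤ η / 4 := by linarith
    exact mul_le_mul_of_nonneg_right this hlog0.le
  have hmain := hq₀ q χ β a x (le_trans (le_max_left _ _) hq) hprim hquad hzero hqual ha le_rfl hxle
  -- the right side of Corollary 6.1 is positive at `x = q⁴³`
  have hL : 0 < (χ.LFunction 1).re :=
    Siegel.LFunction_one_re_pos χ hne hquad.sq_eq_one
  have hV : 0 < sieveProduct χ := sieveProduct_pos χ
  have hφ : (0 : ℝ) < (Nat.totient q : ℝ) := by
    exact_mod_cast Nat.totient_pos.mpr (Nat.pos_of_ne_zero (NeZero.ne q))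
  have hxpos : 0 < x := by positivity
  have hpos : 0 < (χ.LFunction 1).re * (sieveProduct χ / (Nat.totient q : ℝ)) * (x / 168) := by
    positivity
  exact exists_prime_of_piMod_pos hx0 (lt_of_lt_of_le hpos hmain)

end FriedlanderIwaniec2023

end Literature.NumberTheory.LFunctions

end
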